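import Mathlib

/-!
# Truncated unipotent characters in characteristic `p` (solo-informed programme, Part II §7.8 (E5)(α))

The elementary fact behind clause (α) of the beyond-first-order mechanism in the "silent cell":
in a commutative ring `A` of characteristic `p`, a unit `u = 1 + ε w` with `ε` nilpotent of
order exactly `m` (`ε ^ m = 0`, `ε ^ (m - 1) ≠ 0`) and `w` a unit satisfies `u ^ (p ^ k) = 1`
iff `m ≤ p ^ k`.  Consequently an additive character of `ZMod (p ^ e)` (a cyclic factor of
order `p ^ e` of `Cl_F ⊗ ℤ_p`) with value `u` on the generator exists iff `m ≤ p ^ e`: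
partial unramified characters with leading term `ε w` into `𝔽_p[ε]/(ε^m)` continue exactly up
to order `p ^ e` and are obstructed there.  Pure algebra; no arithmetic input.
-/

namespace Summit.Langlands.Langlands.Theorems

open Polynomial

variable {A : Type*} [CommRing A] (p : ℕ) [hp : Fact p.Prime] [CharP A p]

/-- Freshman's dream for a unipotent element: `(1 + ε w)^(p^k) = 1 + ε^(p^k) w^(p^k)`. -/
theorem soloInformed_one_add_mul_pow_char_pow (ε w : A) (k : ℕ) :
    (1 + ε * w) ^ (p ^ k) = 1 + ε ^ (p ^ k) * w ^ (p ^ k) := by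
  rw [add_pow_char_pow (1 : A) (ε * w) p k, one_pow, mul_pow]

omit hp [CharP A p] in
/-- If `ε ^ m = 0` and `ε ^ (m - 1) ≠ 0` then `ε ^ j = 0 ↔ m ≤ j`. -/
theorem soloInformed_pow_eq_zero_iff {ε : A} {m : ℕ} (hm : ε ^ m = 0) (hm' : ε ^ (m - 1) ≠ 0)
    (j : ℕ) : ε ^ j = 0 ↔ m ≤ j := by
  constructor
  · intro hj
    by_contra h
    push Not at h
    apply hm'
    have : m - 1 = j + (m - 1 - j) := by omega
    rw [this, pow_add, hj, zero_mul]
  · intro hj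
    obtain ⟨d, rfl⟩ := Nat.exists_eq_add_of_le hj
    rw [pow_add, hm, zero_mul]

/-- The order statement: for `ε` nilpotent of order exactly `m` and `w` a unit,
`(1 + ε w) ^ (p ^ k) = 1 ↔ m ≤ p ^ k`. -/
theorem soloInformed_truncatedChar_pow_eq_one_iff {ε w : A} {m : ℕ} (hm : ε ^ m = 0)
    (hm' : ε ^ (m - 1) ≠ 0) (hw : IsUnit w) (k : ℕ) :
    (1 + ε * w) ^ (p ^ k) = 1 ↔ m ≤ p ^ k := by
  rw [soloInformed_one_add_mul_pow_char_pow p ε w k, add_eq_left,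
    ← soloInformed_pow_eq_zero_iff hm hm' (p ^ k)]
  constructor
  · intro h
    have hu : IsUnit (w ^ (p ^ k)) := hw.pow _
    obtain ⟨v, hv⟩ := hu.exists_left_inv
    calc ε ^ (p ^ k) = ε ^ (p ^ k) * (w ^ (p ^ k) * v) := by
            rw [mul_comm (w ^ (p ^ k)) v, hv, mul_one]
      _ = 0 := by rw [← mul_assoc, h, zero_mul]
  · intro h
    rw [h, zero_mul]

/-- Clause (α): an additive character of `ZMod (p ^ e)` taking the value `u = 1 + ε w` on `1`
exists iff `m ≤ p ^ e`. -/
theorem soloInformed_truncatedChar_exists_iff {ε w : A} {m : ℕ} (hm : ε ^ m = 0)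
    (hm' : ε ^ (m - 1) ≠ 0) (hw : IsUnit w) (u : Aˣ) (hu : (u : A) = 1 + ε * w) (e : ℕ) :
    (∃ f : ZMod (p ^ e) →+ Additive Aˣ, f 1 = Additive.ofMul u) ↔ m ≤ p ^ e := by
  have key : u ^ (p ^ e) = 1 ↔ m ≤ p ^ e := by
    rw [← soloInformed_truncatedChar_pow_eq_one_iff p hm hm' hw e, ← hu, ← Units.val_pow_eq_pow_val,
      Units.val_eq_one]
  constructor
  · rintro ⟨f, hf⟩
    rw [← key]
    have h1 : ((p ^ e : ℕ) : ZMod (p ^ e)) = 0 := ZMod.natCast_self _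
    have h2 : f ((p ^ e : ℕ) : ZMod (p ^ e)) = (p ^ e) • f 1 := by
      rw [← map_nsmul, nsmul_one]
    rw [h1, map_zero, hf] at h2
    -- `(p^e) • ofMul u = ofMul (u ^ (p^e))`
    have h3 : (p ^ e) • Additive.ofMul u = Additive.ofMul (u ^ (p ^ e)) := by
      rw [ofMul_pow]
    rw [h3] at h2
    exact (Additive.ofMul.injective h2.symm)
  · intro hle
    have hpow : u ^ (p ^ e) = 1 := key.mpr hle
    refine ⟨ZMod.lift (p ^ e) ⟨zmultiplesHom (Additive Aˣ) (Additive.ofMul u), ?_⟩, ?_⟩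
    · change (zmultiplesHom (Additive Aˣ) (Additive.ofMul u)) ((p ^ e : ℕ) : ℤ) = 0
      rw [zmultiplesHom_apply, natCast_zsmul, ← ofMul_pow, hpow, ofMul_one]
    · rw [show (1 : ZMod (p ^ e)) = ((1 : ℤ) : ZMod (p ^ e)) by simp, ZMod.lift_coe]
      simp
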